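import Mathlib.NumberTheory.ArithmeticFunction.VonMangoldt
import Mathlib.NumberTheory.ArithmeticFunction.Moebius
import Mathlib.MeasureTheory.Integral.IntervalIntegral.Basic
import Literature.NumberTheory.Sieve.AsymptoticSieveForPrimesInputs
import Literature.NumberTheory.Sieve.AsymptoticSieveForPrimesProofs
import HarnessLib

/-!
# Asymptotic sieve for primes: the decomposition (3.4) and the five term estimates

Trunk T-SIEVE. Source: J. Friedlander, H. Iwaniec, *Asymptotic sieve for primes*, Ann. of Math. 148
(1998) 1041–1065 [FriedlanderIwaniecASP1998] (= arXiv:math/9811186), §3 "Combinatorial identities"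
((3.1)–(3.5), pp. 1050–1052) and the statements of §§4–8 ((4.5) p. 1054, (5.1) p. 1054, (6.6)
p. 1056, (7.2) p. 1057, (8.5) p. 1058), whose combination is the proof of Theorem 1 (p. 1058:
"Combining (3.4), (3.5), (4.5), (5.1), (6.6), (7.2) and (8.5) we complete the proof of Theorem 1").

This file is the second step (after `Literature.NumberTheory.Sieve.AsymptoticSieveForPrimesInputs`)
of the decomposition of the named fact `Literature.NumberTheory.Sieve.fi_asymptotic_sieve_primes_loglog` (FI Theorem 1 in
its working regime `δ = (log x)^α`, `Δ = x^θ`; `Literature.NumberTheory.Sieve.AsymptoticSieveForPrimes`)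
into the results its printed proof consumes. It PROVES the combinatorial skeleton of FI §3 and
STATES the five analytic term estimates of §§4–8 as named facts; the sibling file
`AsymptoticSieveForPrimesAssembly` proves that these facts (with Brun's sieve and `H > 0`) imply
`fi_asymptotic_sieve_primes_loglog`.

## Contents

* Real truncations of arithmetic functions `truncLE f z = f(n ≤ z)`, `truncGT f z = f(n > z)`,
  `truncIoc f a b = f(b ≥ n > a)` (FI §3, first display), and the PROVED identity
  `fi_combinatorial_identity` (FI (3.1)): for `y, z ≥ 0`, `s ≥ 1`,
  `f(> z) = μ(≤ y) * F - μ(≤ y) * f(≤ z) * 1 + μ(> sy) * f(> sz) * 1 + μ(sy ≥ · > y) * f(> z) * 1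
    + μ(> sy) * f(sz ≥ · > z) * 1` (`F = f * 1`, Dirichlet convolutions);
* the sums of FI (3.4) for a sieve sequence `A`, weights `λ` (`ρ = sieveRho λ`) and real
  `s, x, y, z`: `rhoSum` (`∑_{n ≤ x} a_n ρ_n F(n)`), `fiT` (`T(x; y)`), `fiTyz` (`T(x; y, z)`),
  `fiS1`, `fiS2`, `fiS3` (`S_j(x; y, z)`), `fiTail` (`S♯(x, z) = ∑_{z < n ≤ x} a_n Λ(n)`), and the
  PROVED pointwise decomposition `FIAsymptoticSieveHypotheses.fiTail_eq_decomposition` (FI (3.4)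
  before smoothing): `S♯(x, z) = T(x; y) - T(x; y, z) + S₁ + S₂ + S₃` whenever the sifting range of
  the weights is `≤ z` (uses (1.16) and `ρ_p = 1` for primes beyond the sifting range);
* the smoothing operator `logAvg h Y = ∫_Y^{eY} h(y) dy/y` (FI's `I_h(Y, Z)` in one variable),
  `fiSmooth` (`S(x, Z)`), `fiS2Y` (`S₂(x; Y, z)`, FI (7.1)), `fiS3Z` (`S₃(x; y, Z)`, FI §8);
* the parameters: `fiY D θ x = √D / x^{θ/2}` (FI (3.3) `Y = Z = Δ⁻¹√D` with the structural
  `Δ = x^{θ/2}`, see below), `fiSLow`/`IsFISplit` (the power of `2`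
  `s ∈ (Δ√x/(8δ√D), Δ√x/(4δ√D)]`), `fiSieveDensity g ε` (`w_ε = g h` of FI §6), and the
  `Prop`-structure `FIRegime A D α θ θ₁ lam` (the hypotheses of Theorem 1 with `δ = (log x)^α`,
  `Δ_B = x^θ`, `0 < θ < 1/3`, plus upper-bound sieve weights `lam x` of sifting range `x^{θ₁}` and
  level `x^{θ/2}` for large `x`, `0 < θ₁ ≤ θ/2`);
* NAMED FACTS (`Prop`): `fi_densityConstant_pos` (FI (1.13)–(1.14): `H > 0`),
  `fi_asp_T_estimate` (FI (4.5)), `fi_asp_Tyz_estimate` (FI (5.1)), `fi_sieve_density_admissible`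
  (FI §6 p. 1056: "`g(p)h(p) < 1`, so the sieve theory applies"), `fi_asp_S1_estimate` (FI (6.6)),
  `fi_asp_S2_estimate` (FI (7.2)), `fi_asp_S3_estimate` (FI (8.5)).

## Faithfulness notes

* The regime. FI p. 1044: "In practice (B) can be established in the range (B1) for `δ = (log x)^α`
  and `Δ = x^η` … For the proof we may assume that `x ≥ Δ(x)^A`, `Δ(x) ≥ δ(x)^A`, and `δ(x) ≥ A` for
  any fixed positive constant `A`. Note also that it suffices to prove the Theorem with `Δ(x)` in
  the inequality (B1) replaced by `Δ(x)^A` (and similarly for `δ(x)`)." Accordingly the term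
  estimates are stated in the regime of `fi_asymptotic_sieve_primes_loglog` (`δ = (log x)^α`,
  hypothesis (B) for `Δ_B = x^θ`, `0 < θ < 1/3`) with FI's structural parameter taken to be
  `Δ = Δ_B^{1/2} = x^{θ/2}` (so `A = 2`): then for large `x` one has `Z = Δ⁻¹√D > Δ` (p. 1052),
  `Δy < D` (§4), `yz ≤ e²Δ⁻²D < Δ⁻¹D` (§5), `[cd, ν] < δ³Δ√x·O(1) < D` (§6), and the range
  `y ∈ (Y/ν₂, eY/ν₂]`, `ν₂ ≤ Δ`, of (7.1) stays inside (B1) because `Y/Δ = Δ_B⁻¹√D` (§7). Each fact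
  is FI's displayed estimate specialised to this regime — implied by, never stronger than, the
  printed claim; the error `A(x) log δ / log Δ` of (6.6) is written `A(x) log log x / log x`
  (equal up to the constant `2α/θ₁`).
* The sieve weights. FI use "an upper-bound sieve `{λ_ν, ν ≤ Δ}` of level `Δ`" with `ρ_n ≥ 0`
  (§3) and, in §6 only, "the sieve theory applies giving `∑_ν λ_ν g(ν)h(ν) ≪ ∏_{p<Δ}(1 - g(p)h(p))`".
  The facts quantify over all weight systems `lam x` with `IsUpperSieveWeights (x^{θ₁}) (x^{θ/2})`
  (`Inputs`; sifting range `x^{θ₁} ≤` level `x^{θ/2}`, so that Brun's weights of range `z` and level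
  `z^c` qualify with `θ₁ = θ/(2 max(c, 1))`); (6.6) additionally assumes the displayed sieve bound
  at the sifting range for FI's densities `w_ε`, `0 < ε ≤ 1` (FI take `ε = 1/log Δ`) — demanded for
  more `ε` than FI use, hence a weaker fact. §§4, 5, 7, 8 use only `λ₁ = 1`, `|λ_ν| ≤ 1`,
  `λ_ν = 0` for `ν > Δ`, all part of `IsUpperSieveWeights`.
* `s`. FI: "`s` … the power of `2` in the interval `Δ√x/(8δ√D) < s ≤ Δ√x/(4δ√D)`" (needed as a
  power of `2` for the dyadic applications of (B′) in (7.1), (8.1)); `IsFISplit` says exactly this.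
* (3.4)–(3.5) are proved here/in the assembly in the pointwise-then-averaged form: FI apply the
  operator `I_h(Y, Z) = ∫_Y^{eY}∫_Z^{eZ} h(y, z) dy dz/(yz)` to (3.1); (7.2) is FI's bound for the
  `y`-average `S₂(x; Y, z)` at each `z`, (8.5) for the `z`-average `S₃(x; y, Z)` at each `y`,
  (4.5), (5.1), (6.6) are "for individual `y`, `z`" as printed.
* Implied constants become `∃ K, ∀ᶠ x in atTop, …` (FI: depending on `g` only; an existential
  constant depending on everything fixed is implied by, never stronger than, that).

## Mathlib search

Mathlib has `ArithmeticFunction` with Dirichlet convolution, `μ`, `Λ`, `ζ`,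
`coe_moebius_mul_coe_zeta` (`μ * ζ = 1`), `vonMangoldt_mul_zeta` (`Λ * ζ = log`),
`intervalIntegral`; the tree has `Literature.NumberTheory.Sieve.moebiusTrunc`/`vonMangoldtTrunc` with natural-number cut-offs
and `vaughan_identity_add` (`CircleMethod`), of which (3.1) is the real-cut-off, `s`-split variant
(proved here the same way, by `linear_combination` in the ring of arithmetic functions). No
`T(x; y)`, `S_j`, smoothing operator or any of (4.5)–(8.5) exist in Mathlib or the tree
(`lean search 'fiT|logAvg|Friedlander'`).
-/

noncomputable section

open Filter Asymptotics Finset MeasureTheory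
open scoped ArithmeticFunction.Moebius ArithmeticFunction.vonMangoldt ArithmeticFunction.zeta
  ArithmeticFunction.Omega

namespace Literature.NumberTheory.Sieve

/-! ### Real truncations of arithmetic functions (FI §3) -/

section Trunc

variable {R : Type*} [Semiring R]

/-- `truncLE f z = f(n ≤ z)`: `f(n)` if `n ≤ z`, else `0` (FI §3, first display).
[cite: FriedlanderIwaniecASP1998, §3 p. 1050] -/
def truncLE (f : ArithmeticFunction R) (z : ℝ) : ArithmeticFunction R :=
  ⟨fun n => if (n : ℝ) ≤ z then f n else 0, by simp⟩

/-- `truncGT f z = f(n > z)`: `f(n)` if `n > z`, else `0` (FI §3, first display).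
[cite: FriedlanderIwaniecASP1998, §3 p. 1050] -/
def truncGT (f : ArithmeticFunction R) (z : ℝ) : ArithmeticFunction R :=
  ⟨fun n => if z < (n : ℝ) then f n else 0, by simp⟩

/-- `truncIoc f a b = f(b ≥ n > a)`: `f(n)` if `a < n ≤ b`, else `0` (FI §3, the ranges
`sy ≥ b > y` and `sz ≥ c > z` of `f₂`, `f₃`). [cite: FriedlanderIwaniecASP1998, §3 p. 1050] -/
def truncIoc (f : ArithmeticFunction R) (a b : ℝ) : ArithmeticFunction R :=
  ⟨fun n => if a < (n : ℝ) ∧ (n : ℝ) ≤ b then f n else 0, by simp⟩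

/-- `f(n ≤ z)` unfolded. [folklore] -/
@[simp] theorem truncLE_apply (f : ArithmeticFunction R) (z : ℝ) (n : ℕ) :
    truncLE f z n = if (n : ℝ) ≤ z then f n else 0 := rfl

/-- `f(n > z)` unfolded. [folklore] -/
@[simp] theorem truncGT_apply (f : ArithmeticFunction R) (z : ℝ) (n : ℕ) :
    truncGT f z n = if z < (n : ℝ) then f n else 0 := rfl

/-- `f(b ≥ n > a)` unfolded. [folklore] -/
@[simp] theorem truncIoc_apply (f : ArithmeticFunction R) (a b : ℝ) (n : ℕ) :
    truncIoc f a b n = if a < (n : ℝ) ∧ (n : ℝ) ≤ b then f n else 0 := rfl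

/-- `f(n ≤ z) + f(n > z) = f`. [folklore] -/
theorem truncLE_add_truncGT (f : ArithmeticFunction R) (z : ℝ) : truncLE f z + truncGT f z = f := by
  ext n
  simp only [ArithmeticFunction.add_apply, truncLE_apply, truncGT_apply]
  by_cases h : (n : ℝ) ≤ z
  · simp [h, not_lt.mpr h]
  · simp [h, lt_of_not_ge h]

/-- `f(n > z) = f(w ≥ n > z) + f(n > w)` for `z ≤ w`. [folklore] -/
theorem truncGT_eq_truncIoc_add_truncGT (f : ArithmeticFunction R) {z w : ℝ} (hzw : z ≤ w) :
    truncGT f z = truncIoc f z w + truncGT f w := by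
  ext n
  simp only [ArithmeticFunction.add_apply, truncIoc_apply, truncGT_apply]
  by_cases h1 : z < (n : ℝ)
  · by_cases h2 : (n : ℝ) ≤ w
    · simp [h1, h2, not_lt.mpr h2]
    · simp [h1, h2, lt_of_not_ge h2]
  · have h2 : ¬w < (n : ℝ) := fun h => h1 (lt_of_le_of_lt hzw h)
    simp [h1, h2]

end Trunc

/-! ### The combinatorial identity (3.1) -/

/-- **FI's variant of Vaughan's identity with the `s`-splitting** (FI (3.1)): for an arithmetic
function `f`, `F = f * 1`, and real `y, z ≥ 0`, `s ≥ 1`,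
`f(n > z) = ∑_{b ∣ n} μ(b ≤ y) F(n/b) - ∑_{bc ∣ n} μ(b ≤ y) f(c ≤ z) + f₁ + f₂ + f₃` with
`f₁(n) = ∑_{bc ∣ n} μ(b > sy) f(c > sz)`, `f₂(n) = ∑_{bc ∣ n} μ(sy ≥ b > y) f(c > z)`,
`f₃(n) = ∑_{bc ∣ n} μ(b > sy) f(sz ≥ c > z)`, as an identity of arithmetic functions
(Dirichlet convolutions with `ζ = 1`). Proof: `μ * ζ = δ`, `μ = μ(≤ y) + μ(> y)`,
`μ(> y) = μ(sy ≥ · > y) + μ(> sy)`, `f(> z) = f(sz ≥ · > z) + f(> sz)`.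
[cite: FriedlanderIwaniecASP1998, §3 (3.1)] -/
theorem fi_combinatorial_identity (f : ArithmeticFunction ℝ) {y z s : ℝ} (hy : 0 ≤ y) (hz : 0 ≤ z)
    (hs : 1 ≤ s) :
    truncGT f z =
      truncLE (μ : ArithmeticFunction ℝ) y * (f * ζ)
        - truncLE (μ : ArithmeticFunction ℝ) y * truncLE f z * ζ
        + truncGT (μ : ArithmeticFunction ℝ) (s * y) * truncGT f (s * z) * ζ
        + truncIoc (μ : ArithmeticFunction ℝ) y (s * y) * truncGT f z * ζ
        + truncGT (μ : ArithmeticFunction ℝ) (s * y) * truncIoc f z (s * z) * ζ := by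
  have hμ : ((μ : ArithmeticFunction ℝ) * (ζ : ArithmeticFunction ℝ) : ArithmeticFunction ℝ) = 1 :=
    ArithmeticFunction.coe_moebius_mul_coe_zeta
  have h1 := truncLE_add_truncGT (μ : ArithmeticFunction ℝ) y
  have h2 := truncLE_add_truncGT f z
  have hsy : y ≤ s * y := by nlinarith
  have hsz : z ≤ s * z := by nlinarith
  have h3 := truncGT_eq_truncIoc_add_truncGT (μ : ArithmeticFunction ℝ) hsy
  have h4 := truncGT_eq_truncIoc_add_truncGT f hsz
  -- abbreviate
  set M0 := truncLE (μ : ArithmeticFunction ℝ) y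
  set M1 := truncGT (μ : ArithmeticFunction ℝ) y
  set M2 := truncIoc (μ : ArithmeticFunction ℝ) y (s * y)
  set M3 := truncGT (μ : ArithmeticFunction ℝ) (s * y)
  set F0 := truncLE f z
  set F1 := truncGT f z
  set F2 := truncIoc f z (s * z)
  set F3 := truncGT f (s * z)
  linear_combination (-F1) * hμ - (F1 * (ζ : ArithmeticFunction ℝ)) * h1
    + (M0 * (ζ : ArithmeticFunction ℝ)) * h2 + (F1 * (ζ : ArithmeticFunction ℝ)) * h3
    + (M3 * (ζ : ArithmeticFunction ℝ)) * h4

namespace SieveSequence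

/-! ### The sums of (3.4) -/

/-- The sieve-weighted sum `∑_{1 ≤ n ≤ x} a_n ρ_n F(n)` against an arithmetic function `F`
(`ρ_n = ∑_{ν ∣ n} λ_ν`, `sieveRho`); all five sums of FI (3.4) are of this shape.
[cite: FriedlanderIwaniecASP1998, §3 (3.4)] -/
def rhoSum (A : SieveSequence) (lam : ℕ → ℤ) (F : ArithmeticFunction ℝ) (x : ℝ) : ℝ :=
  ∑ n ∈ Icc 1 ⌊x⌋₊, A.a n * (sieveRho lam n : ℝ) * F n

/-- `rhoSum` unfolded. [cite: FriedlanderIwaniecASP1998, §3 (3.4)] -/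
theorem rhoSum_def (A : SieveSequence) (lam : ℕ → ℤ) (F : ArithmeticFunction ℝ) (x : ℝ) :
    A.rhoSum lam F x = ∑ n ∈ Icc 1 ⌊x⌋₊, A.a n * (sieveRho lam n : ℝ) * F n := rfl

/-- `rhoSum` is additive in `F`. [folklore] -/
theorem rhoSum_add (A : SieveSequence) (lam : ℕ → ℤ) (F G : ArithmeticFunction ℝ) (x : ℝ) :
    A.rhoSum lam (F + G) x = A.rhoSum lam F x + A.rhoSum lam G x := by
  simp only [rhoSum, ArithmeticFunction.add_apply, mul_add, Finset.sum_add_distrib]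

/-- `rhoSum` respects subtraction in `F`. [folklore] -/
theorem rhoSum_sub (A : SieveSequence) (lam : ℕ → ℤ) (F G : ArithmeticFunction ℝ) (x : ℝ) :
    A.rhoSum lam (F - G) x = A.rhoSum lam F x - A.rhoSum lam G x := by
  rw [eq_sub_iff_add_eq, ← rhoSum_add, sub_add_cancel]

/-- FI's `T(x; y) = ∑_{n ≤ x} a_n ρ_n L(n; y)`, `L(n; y) = ∑_{b ∣ n} μ(b ≤ y) log(n/b)`, the sum
carrying the main term `H A(x)`. [cite: FriedlanderIwaniecASP1998, §3 (3.4)] -/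
def fiT (A : SieveSequence) (lam : ℕ → ℤ) (x y : ℝ) : ℝ :=
  A.rhoSum lam (truncLE (μ : ArithmeticFunction ℝ) y * ArithmeticFunction.log) x

/-- FI's `T(x; y, z) = ∑_{n ≤ x} a_n ρ_n L(n; y, z)`, `L(n; y, z) = ∑_{bc ∣ n} μ(b ≤ y) Λ(c ≤ z)`.
[cite: FriedlanderIwaniecASP1998, §3 (3.4)] -/
def fiTyz (A : SieveSequence) (lam : ℕ → ℤ) (x y z : ℝ) : ℝ :=
  A.rhoSum lam (truncLE (μ : ArithmeticFunction ℝ) y * truncLE Λ z * ζ) x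

/-- FI's `S₁(x; y, z) = ∑_{n ≤ x} a_n ρ_n Λ₁(n; y, z)`, `Λ₁(n; y, z) = ∑_{bc ∣ n} μ(b > sy) Λ(c > sz)`.
[cite: FriedlanderIwaniecASP1998, §3 (3.4)] -/
def fiS1 (A : SieveSequence) (lam : ℕ → ℤ) (s x y z : ℝ) : ℝ :=
  A.rhoSum lam (truncGT (μ : ArithmeticFunction ℝ) (s * y) * truncGT Λ (s * z) * ζ) x

/-- FI's `S₂(x; y, z) = ∑_{n ≤ x} a_n ρ_n Λ₂(n; y, z)`,
`Λ₂(n; y, z) = ∑_{bc ∣ n} μ(sy ≥ b > y) Λ(c > z)`. [cite: FriedlanderIwaniecASP1998, §3 (3.4)] -/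
def fiS2 (A : SieveSequence) (lam : ℕ → ℤ) (s x y z : ℝ) : ℝ :=
  A.rhoSum lam (truncIoc (μ : ArithmeticFunction ℝ) y (s * y) * truncGT Λ z * ζ) x

/-- FI's `S₃(x; y, z) = ∑_{n ≤ x} a_n ρ_n Λ₃(n; y, z)`,
`Λ₃(n; y, z) = ∑_{bc ∣ n} μ(b > sy) Λ(sz ≥ c > z)`. [cite: FriedlanderIwaniecASP1998, §3 (3.4)] -/
def fiS3 (A : SieveSequence) (lam : ℕ → ℤ) (s x y z : ℝ) : ℝ :=
  A.rhoSum lam (truncGT (μ : ArithmeticFunction ℝ) (s * y) * truncIoc Λ z (s * z) * ζ) x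

/-- The sharp-cutoff prime sum `S♯(x, z) = ∑_{z < n ≤ x} a_n Λ(n)` (FI's `∑_{n ≤ x} a_n Λ(n > z)`
before smoothing in `z`). [cite: FriedlanderIwaniecASP1998, §3 (3.4)] -/
def fiTail (A : SieveSequence) (x z : ℝ) : ℝ :=
  ∑ n ∈ Ioc ⌊z⌋₊ ⌊x⌋₊, A.a n * Λ n

variable {A : SieveSequence} {D δ Δ : ℝ → ℝ}

/-- `S♯(x, z) = ∑_{n ≤ x} a_n ρ_n Λ(n > z)`: under (1.16) only primes `p > z` contribute, and
`ρ_p = 1` for primes beyond the sifting range `P ≤ z` (FI p. 1052: "Clearly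
`Λ(n > Z) = ρ_n Λ(n > Z)` for squarefree `n` since `Z > Δ`").
[cite: FriedlanderIwaniecASP1998, §3 (3.4)] -/
theorem FIAsymptoticSieveHypotheses.fiTail_eq_rhoSum (h : A.FIAsymptoticSieveHypotheses D δ Δ)
    {P L : ℝ} {lam : ℕ → ℤ} (hw : IsUpperSieveWeights P L lam) {z : ℝ} (hPz : P ≤ z) (hz : 0 ≤ z)
    (x : ℝ) : A.fiTail x z = A.rhoSum lam (truncGT Λ z) x := by
  rw [fiTail, rhoSum]
  have hset : Ioc ⌊z⌋₊ ⌊x⌋₊ = (Icc 1 ⌊x⌋₊).filter (fun n : ℕ => z < (n : ℝ)) := by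
    ext n
    simp only [Finset.mem_Ioc, Finset.mem_filter, Finset.mem_Icc, Nat.floor_lt hz]
    constructor
    · rintro ⟨h1, h2⟩
      refine ⟨⟨?_, h2⟩, h1⟩
      have : (0 : ℝ) < n := lt_of_le_of_lt hz h1
      exact_mod_cast this
    · rintro ⟨⟨-, h2⟩, h1⟩
      exact ⟨h1, h2⟩
  rw [hset, Finset.sum_filter]
  refine Finset.sum_congr rfl fun n _ => ?_
  simp only [truncGT_apply]
  split_ifs with hzn
  · rw [h.a_mul_vonMangoldt]
    split_ifs with hp
    · rw [hw.sieveRho_prime hp (hPz.trans hzn.le)]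
      push_cast
      rw [ArithmeticFunction.vonMangoldt_apply_prime hp]
      ring
    · have := h.a_mul_vonMangoldt n
      rw [if_neg hp] at this
      rw [mul_right_comm, this, zero_mul]
  · rw [mul_zero]

/-- **The decomposition (3.4), pointwise in `y, z`**: for `y, z ≥ 0`, `s ≥ 1`, and sieve weights
whose sifting range `P` is at most `z`,
`∑_{z < n ≤ x} a_n Λ(n) = T(x; y) - T(x; y, z) + S₁(x; y, z) + S₂(x; y, z) + S₃(x; y, z)`
(FI (3.4) before the smoothing operator `I_h(Y, Z)` is applied; it follows from (3.1)–(3.2) with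
`f = Λ`, `F = L = log`, and `Λ(n > z) = ρ_n Λ(n > z)`).
[cite: FriedlanderIwaniecASP1998, §3 (3.2)-(3.4)] -/
theorem FIAsymptoticSieveHypotheses.fiTail_eq_decomposition
    (h : A.FIAsymptoticSieveHypotheses D δ Δ) {P L : ℝ} {lam : ℕ → ℤ}
    (hw : IsUpperSieveWeights P L lam) {x y z s : ℝ} (hy : 0 ≤ y) (hz : 0 ≤ z) (hs : 1 ≤ s)
    (hPz : P ≤ z) :
    A.fiTail x z = A.fiT lam x y - A.fiTyz lam x y z + A.fiS1 lam s x y z + A.fiS2 lam s x y z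
      + A.fiS3 lam s x y z := by
  rw [h.fiTail_eq_rhoSum hw hPz hz, fi_combinatorial_identity Λ hy hz hs,
    ArithmeticFunction.vonMangoldt_mul_zeta, rhoSum_add, rhoSum_add, rhoSum_add, rhoSum_sub]
  rfl

/-! ### Smoothing and parameters (FI §3, (3.3)) -/

/-- The logarithmic average `I_h(Y) = ∫_Y^{eY} h(y) dy/y` (FI's smoothing operator `I_h(Y, Z)` in
one variable; `∫_Y^{eY} dy/y = 1`). [cite: FriedlanderIwaniecASP1998, §3 p. 1051] -/
def logAvg (h : ℝ → ℝ) (Y : ℝ) : ℝ :=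
  ∫ y in Y..(Real.exp 1 * Y), h y / y

/-- The smoothed prime sum `S(x, Z) = ∑_{n ≤ x} a_n Λ(n > Z) = ∫_Z^{eZ} S♯(x, z) dz/z`
(FI (3.4), left-hand side). [cite: FriedlanderIwaniecASP1998, §3 (3.4)] -/
def fiSmooth (A : SieveSequence) (x Z : ℝ) : ℝ :=
  logAvg (fun z => A.fiTail x z) Z

/-- FI's `S₂(x; Y, z) = ∫_Y^{eY} S₂(x; y, z) dy/y` (integrated over `y`, not over `z`; FI (7.1)).
[cite: FriedlanderIwaniecASP1998, §7 (7.1)] -/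
def fiS2Y (A : SieveSequence) (lam : ℕ → ℤ) (s x Y z : ℝ) : ℝ :=
  logAvg (fun y => A.fiS2 lam s x y z) Y

/-- FI's `S₃(x; y, Z) = ∫_Z^{eZ} S₃(x; y, z) dz/z` (integrated over `z`, not over `y`; FI §8,
before (8.4)). [cite: FriedlanderIwaniecASP1998, §8 (8.5)] -/
def fiS3Z (A : SieveSequence) (lam : ℕ → ℤ) (s x y Z : ℝ) : ℝ :=
  logAvg (fun z => A.fiS3 lam s x y z) Z

end SieveSequence

/-- FI's choice (3.3) `Y = Z = Δ⁻¹ √D` of the Vaughan parameters, with the structural parameter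
`Δ = x^{θ/2}` when hypothesis (B) is available for `Δ_B = x^θ` (FI p. 1044: "it suffices to prove
the Theorem with `Δ(x)` in the inequality (B1) replaced by `Δ(x)^A`"; §7 uses (B′) down to
`N > Y/Δ = Δ⁻² √D`). [cite: FriedlanderIwaniecASP1998, §3 (3.3)] -/
def fiY (D : ℝ → ℝ) (θ x : ℝ) : ℝ :=
  Real.sqrt (D x) / x ^ (θ / 2)

/-- The lower end `Δ √x / (8 δ √D)` of FI's interval `(Δ√x/(8δ√D), Δ√x/(4δ√D)]` containing the
splitting parameter `s` (a power of `2`), with `δ = (log x)^α`, `Δ = x^{θ/2}`.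
[cite: FriedlanderIwaniecASP1998, §3 p. 1050] -/
def fiSLow (D : ℝ → ℝ) (α θ x : ℝ) : ℝ :=
  x ^ (θ / 2) * Real.sqrt x / (8 * Real.log x ^ α * Real.sqrt (D x))

/-- `s` is an admissible splitting parameter at `x`: a power of `2` in FI's interval
`(Δ√x/(8δ√D), Δ√x/(4δ√D)]`. [cite: FriedlanderIwaniecASP1998, §3 p. 1050] -/
def IsFISplit (D : ℝ → ℝ) (α θ x s : ℝ) : Prop :=
  (∃ k : ℕ, s = 2 ^ k) ∧ fiSLow D α θ x < s ∧ s ≤ 2 * fiSLow D α θ x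

/-- FI's sieve density in §6: `w_ε(p) = g(p) h(p)` with `h(p) = (1 + p^{-ε})(1 + g(p) p^{-ε})⁻¹`
(FI p. 1055, last display; `ε = (log Δ)⁻¹` on p. 1056). [cite: FriedlanderIwaniecASP1998, §6 p. 1055] -/
def fiSieveDensity (g : ArithmeticFunction ℝ) (ε : ℝ) (p : ℕ) : ℝ :=
  g p * (1 + (p : ℝ) ^ (-ε)) / (1 + g p * (p : ℝ) ^ (-ε))

/-- **The regime of the proof of Theorem 1** (`Prop`-valued structure): fixed exponents `α > 0`
(so `δ = (log x)^α`), `0 < θ < 1/3` (hypothesis (B) for `Δ_B = x^θ`; structural `Δ = x^{θ/2}`, so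
that `Y = Z = Δ⁻¹√D > Δ`, `Δ y < D`, `yz < Δ⁻¹ D`, `δ³ Δ √x < D` and `Y/Δ = Δ_B⁻¹ √D` for large `x`,
as used in FI §§3–8), a sifting-range exponent `0 < θ₁ ≤ θ/2`, the hypotheses of Theorem 1, and
for all large `x` a system `λ = lam x` of combinatorial upper-bound sieve weights of sifting range
`x^{θ₁}` and level `Δ = x^{θ/2}` (FI §3 p. 1051: "an upper-bound sieve `{λ_ν, ν ≤ Δ}` of level `Δ`").
[cite: FriedlanderIwaniecASP1998, §1 p. 1044 and §3 (3.3)] -/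
structure FIRegime (A : SieveSequence) (D : ℝ → ℝ) (α θ θ₁ : ℝ) (lam : ℝ → ℕ → ℤ) : Prop where
  /-- `α > 0`. -/
  α_pos : 0 < α
  /-- `θ₁ > 0`. -/
  θ₁_pos : 0 < θ₁
  /-- `θ₁ ≤ θ/2` (sifting range at most the level). -/
  θ₁_le : θ₁ ≤ θ / 2
  /-- `θ < 1/3`. -/
  θ_lt : θ < 1 / 3
  /-- The hypotheses of Theorem 1 with `δ = (log x)^α`, `Δ_B = x^θ`. -/
  hyp : A.FIAsymptoticSieveHypotheses D (fun x => Real.log x ^ α) (fun x => x ^ θ)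
  /-- Upper-bound sieve weights of sifting range `x^{θ₁}` and level `x^{θ/2}` for large `x`. -/
  weights : ∀ᶠ x : ℝ in atTop, IsUpperSieveWeights (x ^ θ₁) (x ^ (θ / 2)) (lam x)

/-! ### Named facts: the five term estimates (FI §§4–8) and the sieve-density class (§6) -/

/-- **Positivity of the sieve constant `H`** (named fact; FI (1.13)–(1.14), p. 1043: "`H` is the
positive constant `H = -∑_d μ(d) g(d) log d` … That this is positive follows since the series is
also given by the infinite product `H = ∏_p (1 - g(p))(1 - 1/p)⁻¹`"). If `g` is multiplicative with
(1.8) and (1.9), and the ordered Euler product `∏_{p ≤ x} (1 - g(p))(1 - 1/p)⁻¹` tends to `H`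
(`SieveSequence.HasDensityConstant`), then `H > 0`. (Each factor is positive by (1.8), and
`∑_p (g(p) - 1/p)` converges by (1.9) and Mertens' theorem, so the product converges to a positive
limit, which by uniqueness of limits is `H`.) [cite: FriedlanderIwaniecASP1998, (1.13)-(1.14)] -/
def fi_densityConstant_pos : Prop :=
  ∀ (g : ArithmeticFunction ℝ), g.IsMultiplicative →
    (∃ K : ℝ, ∀ p : ℕ, p.Prime → 0 ≤ g p ∧ g p < 1 ∧ g p ≤ K / p) →
    (∃ c K : ℝ, ∀ y : ℝ, 2 ≤ y →
      |(∑ p ∈ Nat.primesLE ⌊y⌋₊, g p) - (Real.log (Real.log y) + c)| ≤ K / Real.log y ^ 10) →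
    ∀ H : ℝ,
      Tendsto (fun x : ℕ => ∏ p ∈ Nat.primesLE x, (1 - g p) / (1 - (p : ℝ)⁻¹)) atTop (nhds H) →
        0 < H

/-- **Evaluation of `T(x; Y)`** (named fact; FI §4, (4.5): "`T(x, y) = HA(x) + O(A(x)(log x)^{-2})`",
proved for individual `x, y` from (R′) [`Δy < D`], (2.4) and the evaluation
`∑_{η ∣ ν} μ(η) ∑_{(b,ν)=1} μ(b) g(b) log ηb = -H [ν = 1]` (FI (1.13)–(1.14))). In the regime
`FIRegime` (with `H` the Euler product `SieveSequence.HasDensityConstant`): there is `K` such that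
for all large `x` and all `y ∈ [Y, eY]`, `Y = fiY D θ x`, `|T(x; y) - H A(x)| ≤ K A(x) (log x)^{-2}`.
[cite: FriedlanderIwaniecASP1998, §4 (4.5)] -/
def fi_asp_T_estimate : Prop :=
  ∀ (A : SieveSequence) (D : ℝ → ℝ) (α θ θ₁ : ℝ) (lam : ℝ → ℕ → ℤ) (H : ℝ),
    FIRegime A D α θ θ₁ lam → A.HasDensityConstant H →
      ∃ K : ℝ, ∀ᶠ x : ℝ in atTop, ∀ y : ℝ, fiY D θ x ≤ y → y ≤ Real.exp 1 * fiY D θ x →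
        |A.fiT (lam x) x y - H * A.size x| ≤ K * A.size x / Real.log x ^ 2

/-- **Estimation of `T(x; Y, Z)`** (named fact; FI §5, (5.1): "`T(x; y, z) ≪ A(x)(log x)^{-2}`",
for individual `y, z`, from (2.4), (1.8) and (R′) [`yz ≤ e² Δ⁻² D < Δ⁻¹ D`]). In the regime
`FIRegime`: there is `K` such that for all large `x` and all `y, z ∈ [Y, eY]` (`Y = Z = fiY D θ x`),
`|T(x; y, z)| ≤ K A(x) (log x)^{-2}`. [cite: FriedlanderIwaniecASP1998, §5 (5.1)] -/
def fi_asp_Tyz_estimate : Prop :=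
  ∀ (A : SieveSequence) (D : ℝ → ℝ) (α θ θ₁ : ℝ) (lam : ℝ → ℕ → ℤ),
    FIRegime A D α θ θ₁ lam →
      ∃ K : ℝ, ∀ᶠ x : ℝ in atTop, ∀ y : ℝ, fiY D θ x ≤ y → y ≤ Real.exp 1 * fiY D θ x →
        ∀ z : ℝ, fiY D θ x ≤ z → z ≤ Real.exp 1 * fiY D θ x →
          |A.fiTyz (lam x) x y z| ≤ K * A.size x / Real.log x ^ 2

/-- **The sieve axioms for FI's density `w_ε = g h`** (named fact; FI §6 p. 1056: "Note that
`g(p)h(p) < 1`, so the sieve theory applies"). If `g` is multiplicative with (1.8)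
`0 ≤ g(p) < 1`, `g(p) ≪ p⁻¹`, then there are `κ > 0`, `A₁ ≥ 1`, `A₂` such that for every
`0 < ε ≤ 1` the density `w_ε(p) = g(p)(1 + p^{-ε})(1 + g(p)p^{-ε})⁻¹` (`fiSieveDensity`) satisfies
the hypotheses of Brun's sieve (Cojocaru–Murty Thm 6.2.5 (2)–(3)): `0 ≤ w_ε(p) ≤ 1 - 1/A₁` and
`∑_{u ≤ p < v} w_ε(p) log p ≤ κ log(v/u) + A₂` for `2 ≤ u ≤ v`. (Elementary: `w_ε(p) ≤ 2g(p) ≤ 2K/p`,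
`w_ε(p) ≤ 2g(p)/(1 + g(p))` with `sup_p g(p) < 1` by (1.8), and Mertens–Chebyshev
`∑_{u ≤ p < v} log p / p ≤ log(v/u) + O(1)`.) [cite: FriedlanderIwaniecASP1998, §6 p. 1056] -/
def fi_sieve_density_admissible : Prop :=
  ∀ (g : ArithmeticFunction ℝ), g.IsMultiplicative →
    (∃ K : ℝ, ∀ p : ℕ, p.Prime → 0 ≤ g p ∧ g p < 1 ∧ g p ≤ K / p) →
    ∃ κ A₁ A₂ : ℝ, 0 < κ ∧ 1 ≤ A₁ ∧ ∀ ε : ℝ, 0 < ε → ε ≤ 1 →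
      (∀ p : ℕ, p.Prime → 0 ≤ fiSieveDensity g ε p ∧ fiSieveDensity g ε p ≤ 1 - 1 / A₁) ∧
      (∀ u v : ℝ, 2 ≤ u → u ≤ v →
        ∑ p ∈ (Nat.primesBelow ⌈v⌉₊).filter (fun p : ℕ => u ≤ (p : ℝ)),
            fiSieveDensity g ε p * Real.log p ≤ κ * Real.log (v / u) + A₂)

/-- **Estimation of `S₁(x; Y, Z)`** (named fact; FI §6, (6.6): "`S₁(x; y, z) ≪ A(x) log δ / log Δ`",
for individual `y, z`, from (R′) [`[cd, ν] ≤ cdν < δ³Δ√x < D`], (6.4) `L(x) ≪ log δ` by (1.8),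
the positivity `∑_ν λ_ν g(ν/(ν,d)) ≥ 0` of any upper-bound sieve, Rankin's trick and "the sieve
theory applies giving `∑_ν λ_ν g(ν)h(ν) ≪ ∏_{p<Δ} (1 - g(p)h(p))`" with `ε = (log Δ)⁻¹`, (6.5)).
In the regime `FIRegime`, for weights satisfying that sieve bound at the sifting range `x^{θ₁}`
for all `0 < ε ≤ 1` (the hypothesis `hB`; supplied by Brun's sieve, `brun_upperSieveWeights`, and
`fi_sieve_density_admissible`): there is `K` such that for all large `x`, every admissible `s`
(`IsFISplit`) and all `y, z ∈ [Y, eY]`, `|S₁(x; y, z)| ≤ K A(x) log log x / log x`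
(`= A(x) log δ / log Δ` up to the constant `2α/θ₁`). [cite: FriedlanderIwaniecASP1998, §6 (6.6)] -/
def fi_asp_S1_estimate : Prop :=
  ∀ (A : SieveSequence) (D : ℝ → ℝ) (α θ θ₁ : ℝ) (lam : ℝ → ℕ → ℤ),
    FIRegime A D α θ θ₁ lam →
    (∃ C : ℝ, ∀ᶠ x : ℝ in atTop, ∀ ε : ℝ, 0 < ε → ε ≤ 1 →
      ∑ d ∈ (primesProdBelow (x ^ θ₁)).divisors,
          (lam x d : ℝ) * ∏ p ∈ d.primeFactors, fiSieveDensity A.density ε p ≤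
        C * ∏ p ∈ Nat.primesBelow ⌈x ^ θ₁⌉₊, (1 - fiSieveDensity A.density ε p)) →
      ∃ K : ℝ, ∀ᶠ x : ℝ in atTop, ∀ s : ℝ, IsFISplit D α θ x s →
        ∀ y : ℝ, fiY D θ x ≤ y → y ≤ Real.exp 1 * fiY D θ x →
        ∀ z : ℝ, fiY D θ x ≤ z → z ≤ Real.exp 1 * fiY D θ x →
          |A.fiS1 (lam x) s x y z| ≤ K * A.size x * Real.log (Real.log x) / Real.log x

/-- **Estimation of `S₂(x; Y, Z)`** (named fact; FI §7, (7.1)–(7.2): "`S₂(x; Y, z) ≪ A(x)(log x)^{-1}`",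
the `y`-integrated sum, from (B′) applied on the dyadic pieces of `y < b ≤ sy` after removing `ν₂`
from the range by the integration over `y`). In the regime `FIRegime`: there is `K` such that for
all large `x`, every admissible `s` and every `z ∈ [Z, eZ]`,
`|∫_Y^{eY} S₂(x; y, z) dy/y| ≤ K A(x) / log x`. [cite: FriedlanderIwaniecASP1998, §7 (7.2)] -/
def fi_asp_S2_estimate : Prop :=
  ∀ (A : SieveSequence) (D : ℝ → ℝ) (α θ θ₁ : ℝ) (lam : ℝ → ℕ → ℤ),
    FIRegime A D α θ θ₁ lam →
      ∃ K : ℝ, ∀ᶠ x : ℝ in atTop, ∀ s : ℝ, IsFISplit D α θ x s →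
        ∀ z : ℝ, fiY D θ x ≤ z → z ≤ Real.exp 1 * fiY D θ x →
          |A.fiS2Y (lam x) s x (fiY D θ x) z| ≤ K * A.size x / Real.log x

/-- **Estimation of `S₃(x; Y, Z)`** (named fact; FI §8, (8.1)–(8.5): "`S₃(x; y, Z) ≪ A(x)(log x)^{-1}`",
the `z`-integrated sum, from `μ(c)Λ(c) = λ⁺(c) - λ⁻(c)` with `C = x/D`,
`λ⁻(c) = ∫_1^C γ(c, t) dt/t`, (B′) applied `log₂ s` times (8.1), (2.4) for the main terms (8.3) and
(R′) after the integration over `z` (8.4)). In the regime `FIRegime`: there is `K` such that for all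
large `x`, every admissible `s` and every `y ∈ [Y, eY]`, `|∫_Z^{eZ} S₃(x; y, z) dz/z| ≤ K A(x) / log x`.
[cite: FriedlanderIwaniecASP1998, §8 (8.5)] -/
def fi_asp_S3_estimate : Prop :=
  ∀ (A : SieveSequence) (D : ℝ → ℝ) (α θ θ₁ : ℝ) (lam : ℝ → ℕ → ℤ),
    FIRegime A D α θ θ₁ lam →
      ∃ K : ℝ, ∀ᶠ x : ℝ in atTop, ∀ s : ℝ, IsFISplit D α θ x s →
        ∀ y : ℝ, fiY D θ x ≤ y → y ≤ Real.exp 1 * fiY D θ x →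
          |A.fiS3Z (lam x) s x y (fiY D θ x)| ≤ K * A.size x / Real.log x

end Literature.NumberTheory.Sieve
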